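import Mathlib.NumberTheory.NumberField.Discriminant.Defs
import Literature.NumberTheory.LFunctions.EffectivePrimeIdealTheoremGRH
import Literature.NumberTheory.LFunctions.PrimeIdealPsi
import HarnessLib

/-!
# The effective prime ideal theorem under GRH: the last step (from `ψ_K` to `π_K − Li`)

Topic `Literature/NumberTheory/LFunctions`, companion of `EffectivePrimeIdealTheoremGRH.lean`, whose
named fact `Literature.NumberTheory.LFunctions.NumberField.effectivePrimeIdealTheorem_of_ERH`
(Lagarias–Odlyzko 1977, Thm. 1.1; Serre 1981, Thm. 4, (14_R), case `E = K`) reads: there is an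
absolute `c > 0` with `|π_K(x) − Li(x)| ≤ c √x (log |d_K| + [K:ℚ] log x)` for every number field `K`
satisfying GRH and every `x ≥ 2`.

The analytic heart of Lagarias–Odlyzko's proof (the partial-fraction decomposition of
`ζ_L'/ζ_L` with constants uniform in the field, the density of zeros
`n_L(t) ≪ log d_L + n_L log(|t| + 2)`, and the truncated explicit formula) produces the
`ψ`-form; in Winckler's explicit rendering of that proof (Winckler 2013, Théorème 8.1, case
`L = K`, `C = G = {1}`): under GRH for `ζ_K`, for all `x ≥ 2`,
`|ψ_K(x) − x| ≤ √x log x [(23/3 + 4781/(96 log x)) log d_K + ((863/31) log x + 68/3 + 58681/(113 log x)) n_K]`,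
which for `x ≥ 2` is `≤ c √x log x (log d_K + n_K log x)` with an absolute `c`. The theorem for
`π_K` (Lagarias–Odlyzko's Thm. 1.1; Winckler's Thm. 1.2) then follows by the elementary last step
(Winckler 2013, §8: "`ψ_C(x) − θ_C(x) ≤ (22/15) n_K √x log x`" and "Une transformée d'Abel donne les
théorèmes … : `π_C(x) − (|C|/|G|) Li(x) = (θ_C(x) − (|C|/|G|)x)/log x + ∫₂ˣ (θ_C(t) − (|C|/|G|)t) dt/(t log² t)`")
formalised, sorry-free and with explicit absolute constants, in this file:

1. prime-ideal powers: `0 ≤ ψ_K(t) − θ_K(t) ≤ π_K(√t) log t ≤ (ψ_K(√t)/log 2) log t`, so a bound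
   `|ψ_K(u) − u| ≤ R √u log u` on `[2, x]` gives `|θ_K(t) − t| ≤ (R + (1 + 2R)/log 2) √t log t` on
   `[2, x]` (`abs_chebyshevThetaIdeal_sub_self_le_of_psi_bound`);
2. partial summation `π_K(x) − Li(x) = (θ_K(x) − x)/log x + 2/log 2 + ∫₂ˣ (θ_K(t) − t) dt/(t log² t)`
   (the tree's `primeIdealCount_eq_theta_div_log_add_integral` and
   `offsetLogIntegral_eq_div_log_add_integral`, `PrimeIdealChebyshev.lean`), so a bound
   `|θ_K(t) − t| ≤ R √t log t` on `[2, x]` gives `|π_K(x) − Li(x)| ≤ R (1 + 2/log 2) √x + 2/log 2`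
   (`abs_primeIdealCount_sub_offsetLogIntegral_le_of_theta_bound`): one `log` is gained, exactly as
   between Winckler's Thm. 8.1 and Thm. 1.2;
3. with `R = c (log |d_K| + [K:ℚ] log x)` (monotone in `x`), the `ψ`-form of the GRH prime ideal
   theorem with absolute constant `c` implies `effectivePrimeIdealTheorem_of_ERH` with the absolute
   constant `(c + 1/log² 2 + 2c/log 2)(1 + 2/log 2) + √2/log² 2`
   (`effectivePrimeIdealTheorem_of_ERH_of_chebyshevPsiIdeal`).

Nothing here is conditional: GRH is only threaded through. What remains for the discharge
`effectivePrimeIdealTheorem_of_ERH_holds` is the `ψ`-form itself (Lagarias–Odlyzko under GRH,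
uniformly in `(d_K, n_K)`; Winckler 2013, §§3–8 with explicit constants); the field-by-field
ingredients are in the tree (Hecke's continuation and
functional equation, `DedekindZetaThetaProofs.lean`, `DedekindZetaFunctionalEquationProofs.lean`; finite
order, `RHGeneralizedRHSelbergProofs.lean`; `−ζ_K'/ζ_K = ∑ Λ_K(n) n^{−s}`, `DedekindZetaVonMangoldt.lean`;
the `K = ℚ` contour argument under RH, `VonKochTheorem.lean`).

## Content (namespace `Literature.NumberTheory.LFunctions.NumberField`)

* `primeIdealCount_mul_log_two_le_chebyshevThetaIdeal` — `π_K(y) log 2 ≤ θ_K(y)`.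
* `chebyshevPsiIdeal_sub_chebyshevThetaIdeal_le_of_psi_bound`,
  `abs_chebyshevThetaIdeal_sub_self_le_of_psi_bound` — step 1.
* `abs_primeIdealCount_sub_offsetLogIntegral_le_of_theta_bound`,
  `abs_primeIdealCount_sub_offsetLogIntegral_le_of_psi_bound` — step 2.
* `abs_primeIdealCount_sub_offsetLogIntegral_le_of_grh_shape` — step 3 for one field, with the
  discriminant and degree replaced by parameters `L ≥ 0`, `n ≥ 1`, and the absolute constant
  `c' = (c + 1/log² 2 + 2c/log 2)(1 + 2/log 2) + √2/log² 2`.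
* `effectivePrimeIdealTheorem_of_ERH_of_chebyshevPsiIdeal` — the reduction of the named fact to its
  `ψ`-form.

## References

* J. C. Lagarias, A. M. Odlyzko, *Effective versions of the Chebotarev density theorem*, in:
  Algebraic Number Fields (Durham 1975), Academic Press 1977, 409–464, Thm. 1.1
  (`LagariasOdlyzko1977`).
* B. Winckler, *Théorème de Chebotarev effectif*, arXiv:1311.5715 (2013), Thm. 1.2, Thm. 8.1 and
  §8 "Estimations finales" (`Winckler2013`).
* J.-P. Serre, *Quelques applications du théorème de densité de Chebotarev*, Publ. Math. IHÉS 54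
  (1981), 123–201, §2.4, Thm. 4 (`Serre1981`).
* H. L. Montgomery, R. C. Vaughan, *Multiplicative Number Theory I*, Cambridge 2007, proof of
  Thm. 13.1, (13.5) (the same partial summation for `K = ℚ`) (`MontgomeryVaughan2007`).
-/

noncomputable section

open scoped NumberField
open Finset Real MeasureTheory

namespace Literature.NumberTheory.LFunctions.NumberField

variable (K : Type*) [Field K] [NumberField K]

/-! ### An elementary inequality -/

/-- `√s · log s ≤ 2 s` for `s ≥ 0` (from `log √s ≤ √s − 1`). [folklore] -/
theorem sqrt_mul_log_le_two_mul {s : ℝ} (hs : 0 ≤ s) : Real.sqrt s * Real.log s ≤ 2 * s := by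
  rcases eq_or_lt_of_le hs with h | h
  · subst h; simp
  have hsq : 0 < Real.sqrt s := Real.sqrt_pos.mpr h
  have h1 : Real.log (Real.sqrt s) ≤ Real.sqrt s - 1 := Real.log_le_sub_one_of_pos hsq
  rw [Real.log_sqrt hs] at h1
  have h2 : Real.log s ≤ 2 * Real.sqrt s := by linarith
  calc Real.sqrt s * Real.log s ≤ Real.sqrt s * (2 * Real.sqrt s) :=
        mul_le_mul_of_nonneg_left h2 hsq.le
    _ = 2 * s := by rw [mul_comm, mul_assoc, Real.mul_self_sqrt hs]

/-! ### Step 1: prime-ideal powers, uniformly -/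

/-- `π_K(y) · log 2 ≤ θ_K(y)`: every nonzero prime ideal has norm `≥ 2`. [folklore] -/
theorem primeIdealCount_mul_log_two_le_chebyshevThetaIdeal (y : ℝ) :
    (primeIdealCount K y : ℝ) * Real.log 2 ≤ chebyshevThetaIdeal K y := by
  rcases lt_or_ge y 0 with hy | hy
  · rw [primeIdealCount_eq_zero_of_lt_two K (by linarith)]
    simpa using chebyshevThetaIdeal_nonneg K y
  rw [chebyshevThetaIdeal_eq_sum_primeIdealsLE K hy, primeIdealCount,
    Set.ncard_eq_toFinset_card _ (finite_primeIdealsLE K y), ← nsmul_eq_mul, ← sum_const]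
  refine sum_le_sum fun P hP => ?_
  rw [Set.Finite.mem_toFinset] at hP
  have h2 : (2 : ℝ) ≤ Ideal.absNorm P := by exact_mod_cast two_le_absNorm_of_isPrime hP.1 hP.2.1
  exact Real.log_le_log two_pos h2

variable {K} in
/-- **Prime-ideal powers under a `√`-type bound for `ψ_K`**: if `|ψ_K(u) − u| ≤ R √u log u` for
`u ∈ [2, x]` (`R ≥ 0`), then for `t ∈ [2, x]`,
`ψ_K(t) − θ_K(t) ≤ ((1 + 2R)/log 2) √t log t`.
Indeed `ψ_K(t) − θ_K(t) ≤ π_K(√t) log t` (`chebyshevPsiIdeal_sub_chebyshevThetaIdeal_le`), which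
vanishes if `√t < 2`, and otherwise `π_K(√t) log 2 ≤ θ_K(√t) ≤ ψ_K(√t) ≤ √t + R t^{1/4} log √t ≤ (1 + 2R) √t`.
(Winckler, §8, bounds the same difference by `(22/15) n_K √x log x` using the splitting of primes;
the present form avoids the degree.) [cite: Winckler2013, §8] -/
theorem chebyshevPsiIdeal_sub_chebyshevThetaIdeal_le_of_psi_bound {R x : ℝ} (hR : 0 ≤ R)
    (hψ : ∀ u ∈ Set.Icc 2 x, |chebyshevPsiIdeal K u - u| ≤ R * Real.sqrt u * Real.log u)
    {t : ℝ} (ht : t ∈ Set.Icc 2 x) :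
    chebyshevPsiIdeal K t - chebyshevThetaIdeal K t ≤
      (1 + 2 * R) / Real.log 2 * Real.sqrt t * Real.log t := by
  have ht2 : 2 ≤ t := ht.1
  have ht1 : (1 : ℝ) ≤ t := by linarith
  have ht0 : (0 : ℝ) ≤ t := by linarith
  have hlt : 0 ≤ Real.log t := Real.log_nonneg ht1
  have hlog2 : (0.6931471803 : ℝ) < Real.log 2 := Real.log_two_gt_d9
  have hL2 : 0 < Real.log 2 := by linarith
  set s : ℝ := Real.sqrt t with hs
  have hs0 : 0 ≤ s := Real.sqrt_nonneg t
  have hpow := chebyshevPsiIdeal_sub_chebyshevThetaIdeal_le (K := K) ht1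
  rcases lt_or_ge s 2 with hs2 | hs2
  · -- no prime ideal has norm `≤ √t < 2`
    rw [← hs, primeIdealCount_eq_zero_of_lt_two K hs2, Nat.cast_zero, zero_mul] at hpow
    refine hpow.trans ?_
    have : 0 ≤ (1 + 2 * R) / Real.log 2 := by positivity
    positivity
  · -- `√t ∈ [2, x]`
    have hst : s ≤ t := by
      rw [hs, Real.sqrt_le_left ht0]
      nlinarith
    have hsx : s ∈ Set.Icc 2 x := ⟨hs2, hst.trans ht.2⟩
    have hψs : chebyshevPsiIdeal K s ≤ s + R * Real.sqrt s * Real.log s := by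
      have h := (abs_sub_le_iff.mp (hψ s hsx)).1
      linarith
    have hψs' : chebyshevPsiIdeal K s ≤ (1 + 2 * R) * s := by
      have h1 : R * Real.sqrt s * Real.log s ≤ R * (2 * s) := by
        rw [mul_assoc]
        exact mul_le_mul_of_nonneg_left (sqrt_mul_log_le_two_mul hs0) hR
      nlinarith
    have hπ : (primeIdealCount K s : ℝ) ≤ (1 + 2 * R) / Real.log 2 * s := by
      rw [div_mul_eq_mul_div, le_div_iff₀ hL2]
      calc (primeIdealCount K s : ℝ) * Real.log 2 ≤ chebyshevThetaIdeal K s :=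
            primeIdealCount_mul_log_two_le_chebyshevThetaIdeal K s
        _ ≤ chebyshevPsiIdeal K s := chebyshevThetaIdeal_le_chebyshevPsiIdeal K s
        _ ≤ (1 + 2 * R) * s := hψs'
    calc chebyshevPsiIdeal K t - chebyshevThetaIdeal K t
        ≤ (primeIdealCount K s : ℝ) * Real.log t := hpow
      _ ≤ (1 + 2 * R) / Real.log 2 * s * Real.log t := mul_le_mul_of_nonneg_right hπ hlt

variable {K} in
/-- **Step 1** (`θ_K` from `ψ_K`, `√`-type bounds): if `|ψ_K(u) − u| ≤ R √u log u` on `[2, x]`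
(`R ≥ 0`) then `|θ_K(t) − t| ≤ (R + (1 + 2R)/log 2) √t log t` on `[2, x]`.
[cite: Winckler2013, §8] -/
theorem abs_chebyshevThetaIdeal_sub_self_le_of_psi_bound {R x : ℝ} (hR : 0 ≤ R)
    (hψ : ∀ u ∈ Set.Icc 2 x, |chebyshevPsiIdeal K u - u| ≤ R * Real.sqrt u * Real.log u)
    {t : ℝ} (ht : t ∈ Set.Icc 2 x) :
    |chebyshevThetaIdeal K t - t| ≤ (R + (1 + 2 * R) / Real.log 2) * Real.sqrt t * Real.log t := by
  have h1 := hψ t ht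
  have h2 := chebyshevPsiIdeal_sub_chebyshevThetaIdeal_le_of_psi_bound hR hψ ht
  have h3 := chebyshevThetaIdeal_le_chebyshevPsiIdeal K t
  rw [abs_le] at h1 ⊢
  constructor <;> nlinarith [h1.1, h1.2, h2, h3]

/-! ### Step 2: partial summation, uniformly -/

variable {K} in
/-- **Step 2** (`π_K − Li` from `θ_K`, `√`-type bounds; Winckler §8 "Une transformée d'Abel",
Montgomery–Vaughan (13.5) for `K = ℚ`): if `|θ_K(t) − t| ≤ R √t log t` on `[2, x]` (`R ≥ 0`, `x ≥ 2`)
then `|π_K(x) − Li(x)| ≤ R (1 + 2/log 2) √x + 2/log 2`, by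
`π_K(x) − Li(x) = (θ_K(x) − x)/log x + 2/log 2 + ∫₂ˣ (θ_K(t) − t) dt/(t log² t)` and
`∫₂ˣ dt/(√t log t) ≤ (2/log 2) √x` (Winckler uses `≤ 4√x/log x`). [cite: Winckler2013, §8] -/
theorem abs_primeIdealCount_sub_offsetLogIntegral_le_of_theta_bound {R x : ℝ} (hR : 0 ≤ R)
    (hx : 2 ≤ x)
    (hθ : ∀ t ∈ Set.Icc 2 x, |chebyshevThetaIdeal K t - t| ≤ R * Real.sqrt t * Real.log t) :
    |(primeIdealCount K x : ℝ) - offsetLogIntegral x| ≤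
      R * (1 + 2 / Real.log 2) * Real.sqrt x + 2 / Real.log 2 := by
  have hx0 : 0 < x := by linarith
  have hlog2 : (0.6931471803 : ℝ) < Real.log 2 := Real.log_two_gt_d9
  have hL2 : 0 < Real.log 2 := by linarith
  have hL : Real.log 2 ≤ Real.log x := Real.log_le_log two_pos hx
  set L : ℝ := Real.log x with hLdef
  have hLpos : 0 < L := by linarith
  -- decomposition of `π_K − Li`
  have hintθ : IntervalIntegrable (fun t ↦ chebyshevThetaIdeal K t / (t * Real.log t ^ 2))
      volume 2 x := by
    rw [intervalIntegrable_iff, Set.uIoc_of_le hx, ← integrableOn_Icc_iff_integrableOn_Ioc]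
    exact integrableOn_chebyshevThetaIdeal_div K x
  have hint2 : IntervalIntegrable (fun t ↦ 1 / Real.log t ^ 2) volume 2 x :=
    Chebyshev.intervalIntegrable_one_div_log_sq (by norm_num) (by linarith)
  set E : ℝ → ℝ := fun t ↦
    chebyshevThetaIdeal K t / (t * Real.log t ^ 2) - 1 / Real.log t ^ 2 with hE
  have hEint : IntervalIntegrable E volume 2 x := hintθ.sub hint2
  have hdecomp : (primeIdealCount K x : ℝ) - offsetLogIntegral x =
      (chebyshevThetaIdeal K x - x) / L + 2 / Real.log 2 + ∫ t in (2 : ℝ)..x, E t := by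
    rw [primeIdealCount_eq_theta_div_log_add_integral K hx,
      offsetLogIntegral_eq_div_log_add_integral hx, hE, intervalIntegral.integral_sub hintθ hint2,
      hLdef]
    ring
  -- pointwise bound on `E`
  have hEle : ∀ t ∈ Set.Icc 2 x, |E t| ≤ R / Real.log 2 * (Real.sqrt t)⁻¹ := by
    intro t ht
    have ht0 : 0 < t := by linarith [ht.1]
    have hlt : Real.log 2 ≤ Real.log t := Real.log_le_log two_pos ht.1
    have hlt0 : 0 < Real.log t := by linarith
    have hst : 0 < Real.sqrt t := Real.sqrt_pos.mpr ht0
    have hEt : E t = (chebyshevThetaIdeal K t - t) / (t * Real.log t ^ 2) := by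
      simp only [hE]
      field_simp
    rw [hEt, abs_div, abs_of_pos (by positivity : 0 < t * Real.log t ^ 2),
      div_le_iff₀ (by positivity)]
    have hid : (Real.sqrt t)⁻¹ * (t * Real.log t ^ 2) = Real.sqrt t * Real.log t ^ 2 := by
      rw [inv_mul_eq_iff_eq_mul₀ hst.ne', ← mul_assoc, Real.mul_self_sqrt ht0.le]
    calc |chebyshevThetaIdeal K t - t| ≤ R * Real.sqrt t * Real.log t := hθ t ht
      _ = R / Real.log 2 * (Real.sqrt t * Real.log t) * Real.log 2 := by field_simp
      _ ≤ R / Real.log 2 * (Real.sqrt t * Real.log t) * Real.log t :=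
          mul_le_mul_of_nonneg_left hlt (by positivity)
      _ = R / Real.log 2 * (Real.sqrt t)⁻¹ * (t * Real.log t ^ 2) := by
          rw [mul_assoc (R / Real.log 2) (Real.sqrt t)⁻¹, hid]
          ring
  -- the integral of the bound: `∫₂ˣ dt/√t = 2√x − 2√2 ≤ 2√x`
  have hcont : ContinuousOn (fun t : ℝ ↦ (Real.sqrt t)⁻¹) (Set.uIcc 2 x) := by
    refine Real.continuous_sqrt.continuousOn.inv₀ fun t ht ↦ ?_
    have ht0 : 0 < t := by rcases Set.mem_uIcc.1 ht with h | h <;> linarith [h.1]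
    exact (Real.sqrt_pos.2 ht0).ne'
  have hsqrtInt : ∫ t in (2 : ℝ)..x, (Real.sqrt t)⁻¹ ≤ 2 * Real.sqrt x := by
    have hderiv : ∀ t ∈ Set.uIcc (2 : ℝ) x,
        HasDerivAt (fun u ↦ 2 * Real.sqrt u) ((Real.sqrt t)⁻¹) t := by
      intro t ht
      have ht0 : 0 < t := by rcases Set.mem_uIcc.1 ht with h | h <;> linarith [h.1]
      have hst : Real.sqrt t ≠ 0 := (Real.sqrt_pos.2 ht0).ne'
      refine ((Real.hasDerivAt_sqrt ht0.ne').const_mul 2).congr_deriv ?_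
      field_simp
    rw [intervalIntegral.integral_eq_sub_of_hasDerivAt hderiv hcont.intervalIntegrable]
    linarith [Real.sqrt_nonneg 2]
  have hI : |∫ t in (2 : ℝ)..x, E t| ≤ R / Real.log 2 * (2 * Real.sqrt x) := by
    calc |∫ t in (2 : ℝ)..x, E t|
        ≤ ∫ t in (2 : ℝ)..x, |E t| := intervalIntegral.abs_integral_le_integral_abs hx
      _ ≤ ∫ t in (2 : ℝ)..x, R / Real.log 2 * (Real.sqrt t)⁻¹ :=
          intervalIntegral.integral_mono_on hx hEint.abs
            (hcont.intervalIntegrable.const_mul _) hEle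
      _ = R / Real.log 2 * ∫ t in (2 : ℝ)..x, (Real.sqrt t)⁻¹ :=
          intervalIntegral.integral_const_mul _ _
      _ ≤ R / Real.log 2 * (2 * Real.sqrt x) :=
          mul_le_mul_of_nonneg_left hsqrtInt (by positivity)
  -- the boundary term
  have hB : |(chebyshevThetaIdeal K x - x) / L| ≤ R * Real.sqrt x := by
    rw [abs_div, abs_of_pos hLpos, div_le_iff₀ hLpos]
    exact hθ x ⟨hx, le_rfl⟩
  -- assemble
  rw [hdecomp]
  calc |(chebyshevThetaIdeal K x - x) / L + 2 / Real.log 2 + ∫ t in (2 : ℝ)..x, E t|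
      ≤ |(chebyshevThetaIdeal K x - x) / L| + |2 / Real.log 2| + |∫ t in (2 : ℝ)..x, E t| :=
        abs_add_three _ _ _
    _ ≤ R * Real.sqrt x + 2 / Real.log 2 + R / Real.log 2 * (2 * Real.sqrt x) := by
        refine add_le_add_three hB ?_ hI
        rw [abs_of_pos (by positivity)]
    _ = R * (1 + 2 / Real.log 2) * Real.sqrt x + 2 / Real.log 2 := by ring

variable {K} in
/-- Steps 1 and 2 together: if `|ψ_K(u) − u| ≤ R √u log u` on `[2, x]` (`R ≥ 0`, `x ≥ 2`) then
`|π_K(x) − Li(x)| ≤ (R + (1 + 2R)/log 2)(1 + 2/log 2) √x + 2/log 2`. [cite: Winckler2013, §8] -/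
theorem abs_primeIdealCount_sub_offsetLogIntegral_le_of_psi_bound {R x : ℝ} (hR : 0 ≤ R)
    (hx : 2 ≤ x)
    (hψ : ∀ u ∈ Set.Icc 2 x, |chebyshevPsiIdeal K u - u| ≤ R * Real.sqrt u * Real.log u) :
    |(primeIdealCount K x : ℝ) - offsetLogIntegral x| ≤
      (R + (1 + 2 * R) / Real.log 2) * (1 + 2 / Real.log 2) * Real.sqrt x + 2 / Real.log 2 := by
  have hlog2 : (0.6931471803 : ℝ) < Real.log 2 := Real.log_two_gt_d9
  have hR' : 0 ≤ R + (1 + 2 * R) / Real.log 2 := by positivity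
  exact abs_primeIdealCount_sub_offsetLogIntegral_le_of_theta_bound hR' hx
    fun t ht => abs_chebyshevThetaIdeal_sub_self_le_of_psi_bound hR hψ ht

/-! ### Step 3: the GRH shape `√x log x (L + n log x) ⟶ √x (L + n log x)` -/

/-- The absolute constant of the transfer is positive:
`0 < (c + 1/log² 2 + 2c/log 2)(1 + 2/log 2) + √2/log² 2` for `c ≥ 0`. [folklore] -/
theorem grhTransferConst_pos {c : ℝ} (hc : 0 ≤ c) :
    0 < (c + 1 / Real.log 2 ^ 2 + 2 * c / Real.log 2) * (1 + 2 / Real.log 2) +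
      Real.sqrt 2 / Real.log 2 ^ 2 := by
  have hlog2 : (0.6931471803 : ℝ) < Real.log 2 := Real.log_two_gt_d9
  positivity

variable {K} in
/-- **Step 3, one field** (Winckler 2013, from Thm. 8.1 to Thm. 1.2, i.e. Lagarias–Odlyzko's
Thm. 1.1 under GRH, case `L = K`): let `L ≥ 0`, `n ≥ 1`, `c ≥ 0`; if `|ψ_K(t) − t| ≤ c √t log t (L + n log t)` for `2 ≤ t`, then
`|π_K(x) − Li(x)| ≤ c' √x (L + n log x)` for `x ≥ 2`, `c' = (c + 1/log² 2 + 2c/log 2)(1 + 2/log 2) + √2/log² 2`.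
(With `L = log |d_K|`,
`n = [K:ℚ]` this is the passage from the `ψ`-form to (14_R); on `[2, x]` the hypothesis gives
`|ψ_K(t) − t| ≤ R √t log t` with `R = c (L + n log x)`, and `1 ≤ (L + n log x)/log 2`,
`1 ≤ √x (L + n log x)/(√2 log 2)` absorb the constants.) [cite: Winckler2013, §8 (Thm. 8.1 ⟹ Thm. 1.2)] -/
theorem abs_primeIdealCount_sub_offsetLogIntegral_le_of_grh_shape {c L n : ℝ} (hc : 0 ≤ c)
    (hL : 0 ≤ L) (hn : 1 ≤ n)
    (hψ : ∀ t : ℝ, 2 ≤ t →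
      |chebyshevPsiIdeal K t - t| ≤ c * Real.sqrt t * Real.log t * (L + n * Real.log t))
    {x : ℝ} (hx : 2 ≤ x) :
    |(primeIdealCount K x : ℝ) - offsetLogIntegral x| ≤
      ((c + 1 / Real.log 2 ^ 2 + 2 * c / Real.log 2) * (1 + 2 / Real.log 2) +
          Real.sqrt 2 / Real.log 2 ^ 2) * Real.sqrt x * (L + n * Real.log x) := by
  have hx0 : 0 < x := by linarith
  have hlog2 : (0.6931471803 : ℝ) < Real.log 2 := Real.log_two_gt_d9
  have hL2 : 0 < Real.log 2 := by linarith
  have hlx : Real.log 2 ≤ Real.log x := Real.log_le_log two_pos hx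
  set M : ℝ := L + n * Real.log x with hM
  have hM2 : Real.log 2 ≤ M := by
    have : Real.log 2 ≤ n * Real.log x := by nlinarith
    linarith
  have hM0 : 0 ≤ M := hL2.le.trans hM2
  have hsqrt2x : Real.sqrt 2 ≤ Real.sqrt x := Real.sqrt_le_sqrt hx
  have hsqrt2 : 0 < Real.sqrt 2 := Real.sqrt_pos.mpr two_pos
  have hs22 : Real.sqrt 2 * Real.sqrt 2 = 2 := Real.mul_self_sqrt zero_le_two
  -- the hypothesis on `[2, x]` with the constant `R = c M`
  set R : ℝ := c * M with hRdef
  have hR : 0 ≤ R := mul_nonneg hc hM0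
  have hψ' : ∀ u ∈ Set.Icc 2 x, |chebyshevPsiIdeal K u - u| ≤ R * Real.sqrt u * Real.log u := by
    intro u hu
    have hu0 : 0 < u := by linarith [hu.1]
    have hlu : 0 ≤ Real.log u := Real.log_nonneg (by linarith [hu.1])
    have hlux : Real.log u ≤ Real.log x := Real.log_le_log hu0 hu.2
    have hMu : L + n * Real.log u ≤ M := by rw [hM]; nlinarith
    calc |chebyshevPsiIdeal K u - u| ≤ c * Real.sqrt u * Real.log u * (L + n * Real.log u) :=
          hψ u hu.1
      _ ≤ c * Real.sqrt u * Real.log u * M :=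
          mul_le_mul_of_nonneg_left hMu (by positivity)
      _ = R * Real.sqrt u * Real.log u := by rw [hRdef]; ring
  have hmain := abs_primeIdealCount_sub_offsetLogIntegral_le_of_psi_bound hR hx hψ'
  refine hmain.trans ?_
  -- absorb the constants
  have h1 : R + (1 + 2 * R) / Real.log 2 ≤ (c + 1 / Real.log 2 ^ 2 + 2 * c / Real.log 2) * M := by
    have h11 : 1 / Real.log 2 ≤ M / Real.log 2 ^ 2 := by
      rw [div_le_div_iff₀ hL2 (by positivity)]
      nlinarith
    calc R + (1 + 2 * R) / Real.log 2 = c * M + 1 / Real.log 2 + 2 * c / Real.log 2 * M := by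
          rw [hRdef]; ring
      _ ≤ c * M + M / Real.log 2 ^ 2 + 2 * c / Real.log 2 * M := by linarith
      _ = (c + 1 / Real.log 2 ^ 2 + 2 * c / Real.log 2) * M := by ring
  have h2 : 2 / Real.log 2 ≤ Real.sqrt 2 / Real.log 2 ^ 2 * Real.sqrt x * M := by
    calc 2 / Real.log 2 = Real.sqrt 2 * Real.sqrt 2 / Real.log 2 := by rw [hs22]
      _ = Real.sqrt 2 / Real.log 2 ^ 2 * Real.sqrt 2 * Real.log 2 := by
          field_simp
      _ ≤ Real.sqrt 2 / Real.log 2 ^ 2 * Real.sqrt x * M := by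
          refine mul_le_mul (mul_le_mul_of_nonneg_left hsqrt2x (by positivity)) hM2 hL2.le ?_
          positivity
  have h3 : (R + (1 + 2 * R) / Real.log 2) * (1 + 2 / Real.log 2) * Real.sqrt x ≤
      (c + 1 / Real.log 2 ^ 2 + 2 * c / Real.log 2) * M * (1 + 2 / Real.log 2) * Real.sqrt x := by
    refine mul_le_mul_of_nonneg_right (mul_le_mul_of_nonneg_right h1 (by positivity)) ?_
    exact Real.sqrt_nonneg x
  calc (R + (1 + 2 * R) / Real.log 2) * (1 + 2 / Real.log 2) * Real.sqrt x + 2 / Real.log 2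
      ≤ (c + 1 / Real.log 2 ^ 2 + 2 * c / Real.log 2) * M * (1 + 2 / Real.log 2) * Real.sqrt x +
          Real.sqrt 2 / Real.log 2 ^ 2 * Real.sqrt x * M := add_le_add h3 h2
    _ = ((c + 1 / Real.log 2 ^ 2 + 2 * c / Real.log 2) * (1 + 2 / Real.log 2) +
          Real.sqrt 2 / Real.log 2 ^ 2) * Real.sqrt x * M := by ring

/-! ### The reduction of the named fact to its `ψ`-form -/

/-- **The effective prime ideal theorem under GRH from its `ψ`-form** (Lagarias–Odlyzko 1977,
Thm. 1.1, by partial summation from the `ψ_C` estimate; explicitly Winckler 2013, Thm. 1.2 from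
Thm. 8.1, §8; here for `L = K`, `C = G = {1}`): if there is an absolute `c > 0` such that every
number field `K` satisfying GRH has
`|ψ_K(x) − x| ≤ c √x log x (log |d_K| + [K:ℚ] log x)` for all `x ≥ 2`, then the named fact
`effectivePrimeIdealTheorem_of_ERH` (`|π_K(x) − Li(x)| ≤ c' √x (log |d_K| + [K:ℚ] log x)`, `x ≥ 2`,
`c'` absolute) holds, with `c' = (c + 1/log² 2 + 2c/log 2)(1 + 2/log 2) + √2/log² 2`. Winckler's
Thm. 8.1 supplies the hypothesis
with `c = 23/3 + 4781/(96 log 2) + 863/31 + 68/(3 log 2) + 58681/(113 log² 2)` (bounding `1/log x`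
by `1/log 2` and, in the `n_K`-terms, `1` by `log x/log 2`), once proved.
[cite: Winckler2013, §8 (Thm. 8.1 ⟹ Thm. 1.2)] -/
theorem effectivePrimeIdealTheorem_of_ERH_of_chebyshevPsiIdeal
    (h : ∃ c : ℝ, 0 < c ∧ ∀ (K : Type) [Field K] [NumberField K],
      NumberField.ExtendedRiemannHypothesis K → ∀ x : ℝ, 2 ≤ x →
        |chebyshevPsiIdeal K x - x| ≤
          c * Real.sqrt x * Real.log x *
            (Real.log |(_root_.NumberField.discr K : ℝ)| + Module.finrank ℚ K * Real.log x)) :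
    effectivePrimeIdealTheorem_of_ERH := by
  obtain ⟨c, hc, h⟩ := h
  refine ⟨_, grhTransferConst_pos hc.le, fun K _ _ hERH x hx => ?_⟩
  have hL : 0 ≤ Real.log |(_root_.NumberField.discr K : ℝ)| := by
    refine Real.log_nonneg ?_
    have h1 : (1 : ℤ) ≤ |_root_.NumberField.discr K| := Int.one_le_abs (NumberField.discr_ne_zero K)
    exact_mod_cast h1
  have hn : (1 : ℝ) ≤ Module.finrank ℚ K := by exact_mod_cast Module.finrank_pos
  exact abs_primeIdealCount_sub_offsetLogIntegral_le_of_grh_shape hc.le hL hn (h K hERH) hx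

end Literature.NumberTheory.LFunctions.NumberField

end
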